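import Summits.AnomalousDissipation.AnomalousDissipation.Theses.EnsembleRigidity
import Summits.AnomalousDissipation.AnomalousDissipation.Theorems.EnsembleRigidityDefs
import Summits.AnomalousDissipation.AnomalousDissipation.Theorems.EnsembleRigidityGPMeanBoundedFamilyStubHeadModes
import Summits.AnomalousDissipation.AnomalousDissipation.Theorems.EnsembleRigidityGPMeanBoundedFamilyStubLambIdentity
import Summits.AnomalousDissipation.AnomalousDissipation.Theorems.EnsembleRigidityGPMeanBoundedFamilyStubHeadCoefficients
import Summits.AnomalousDissipation.AnomalousDissipation.Theorems.EnsembleRigidityGPMeanBoundedFamilyStubHeadPinned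
import Summits.AnomalousDissipation.AnomalousDissipation.Theorems.EnsembleRigidityGPMeanBoundedFamilyStubSymmetricScheme
import Summits.AnomalousDissipation.AnomalousDissipation.Theorems.EnsembleRigidityGPMeanBoundedFamilyStubSymmetricLimit
import Summits.AnomalousDissipation.AnomalousDissipation.Theorems.TaylorCertificatesSteadyWeakIsGlobalLerayHopf
import Summits.AnomalousDissipation.AnomalousDissipation.Theorems.TaylorCertificatesSteadyStatesLoudBoundedStubGpAdmissible
import Literature.Analysis.FluidPDE.NSHopfGalerkin
import Literature.Analysis.FluidPDE.StatisticalSolution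
import Literature.Analysis.FunctionSpaces.TorusTrigPoly
import Literature.Analysis.FunctionSpaces.TorusCalculus
import Literature.Analysis.FluidPDE.SteadyNavierStokesEnergy

/-!
# Crux `EnsembleRigidity.GPMeanBoundedFamily` (stmt-AnomalousDissipation-15509) — skeleton of line
  `Sketch` (idea `pyritohedral-head-neck-body`), cycle 2 reshape

Composition of the crux from registered stubs. Work in the fixed space of the 24-element stabiliser
`G` of the Galloway–Proctor force `f_GP` (`IsGPSymmetric`, `Theorems/EnsembleRigidityDefs`).

LANDED (all six provable stubs of the line):
* S1 `stub_headModes` (p129757) — `g` smooth/solenoidal/mean-zero; `f_GP`, `g` are `G`-symmetric.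
* S2 `stub_lambIdentity` (p129527) — `(f_GP·∇)f_GP = 2π g` pointwise.
* S3 `stub_headCoefficients` (p130013) — the six head integrals.
* S4 `stub_headPinned` (p130774) — `Fix(G) ∩ {|k|² ≤ 1} = ℝ f_GP`, `Fix(G) ∩ {|k|² ≤ 4} = ℝ f_GP ⊕ ℝ g`.
* S5 `stub_symmetricScheme` (p130354) — a Hopf–Galerkin scheme from rest with `G`-symmetric approximants.
* S6 `stub_symmetricLimit` (p130416) — its global Leray–Hopf limit from rest with `H`-lift and symmetric slices.

OPEN (the crux's content; printed open, Constantin–Tarfulea–Vicol 2013 p. 3), in two registered forms: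
* T2' `stub_steadyBoundedSequence` (cycle-2 reshape of T2 `stub_steadyBoundedBranch`, strictly WEAKER and still
  sufficient: a SEQUENCE `ν_j → 0` instead of every `ν ∈ (0,1]`, and no energy-equality conjunct — in `d = 3`
  every steady weak solution in `V` satisfies `ν‖∇u‖² = (u, f)` (Temam 1979 (1.22),
  `Temam1979_steadyWeakSolution_energy_eq_holds`, in tree)): along some `ν_j ∈ (0,1]`, `ν_j → 0`, steady weak
  solutions of `NS_{ν_j}(f_GP)` in `V = H ∩ H¹` with `ν`-UNIFORMLY bounded energy (route A, primary).  Numerics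
  (LINE-REPORT-c2.md): the primary `G`-symmetric steady branch has `∫‖u‖² = 0.19 … 0.86` for `Re = 1/ν = 16 … 560`,
  growing by `≈ 0.1` per octave without visible saturation; its continuum fate (bounded / log-fat) is open.
* S7 `stub_symmetricMeanCeiling` — a `ν`-uniform bound on the limsup-mean energy of `G`-symmetric
  Leray–Hopf paths from rest, given the head identities (route B).
* `GPMeanBoundedFamily_of` (route A: T2' + Temam's energy equality + `SteadyWeakIsGlobalLerayHopf`, all in
  tree) and `GPMeanBoundedFamily_of_ceiling` (route B: S5 + S6 + S7) both conclude the crux by name.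
-/

noncomputable section

-- every `Summit.AnomalousDissipation.AnomalousDissipation.…` name repeats the summit = sub-problem segment (D-0017 layout)
set_option linter.dupNamespace false

namespace Summit.AnomalousDissipation.AnomalousDissipation.Theorems.EnsembleRigidity.GPMeanBoundedFamily

open MeasureTheory Filter Topology
open scoped InnerProductSpace
open Literature.Analysis.FunctionSpaces Literature.Analysis.FluidPDE
open Summit.AnomalousDissipation.AnomalousDissipation.Theorems.EnsembleRigidity

-- S1 `stub_headModes` LANDED (p129757): `…Theorems.EnsembleRigidityGPMeanBoundedFamilyStubHeadModes`.
-- S2 `stub_lambIdentity` LANDED (p129527): `…Theorems.EnsembleRigidityGPMeanBoundedFamilyStubLambIdentity`.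

-- S3 `stub_headCoefficients` LANDED (p130013): `…Theorems.EnsembleRigidityGPMeanBoundedFamilyStubHeadCoefficients`.

-- S4 `stub_headPinned` LANDED (p130774): `…Theorems.EnsembleRigidityGPMeanBoundedFamilyStubHeadPinned`.

-- S5 `stub_symmetricScheme` LANDED (p130354): `…Theorems.EnsembleRigidityGPMeanBoundedFamilyStubSymmetricScheme`.
-- S6 `stub_symmetricLimit` LANDED (p130416): `…Theorems.EnsembleRigidityGPMeanBoundedFamilyStubSymmetricLimit`.

/-- **S7 `stub_symmetricMeanCeiling`** — THE CONTENT of the crux (printed open: Constantin–Tarfulea–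
Vicol 2013, p. 3; Cheskidov 2023, p. 5): given the head identities S1–S4, there is a level `E` such
that for every `ν ∈ (0, 1]` every `G`-symmetric global Leray–Hopf solution of `NS_ν(f_GP)` from rest
with an `H`-valued lift has limsup-mean energy `≤ E` (the symmetric neck drains the Lamb mode without
hoarding). -/
theorem stub_symmetricMeanCeiling :
    ((Torus.IsSmooth lambMode ∧ Torus.IsDivFree lambMode ∧ Torus.HasZeroMean lambMode) ∧
      IsGPSymmetric gpForce ∧ IsGPSymmetric lambMode) →
    (∀ x : UnitAddTorus (Fin 3), Torus.convect gpForce gpForce x = (2 * Real.pi) • lambMode x) →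
    ((∫ x : UnitAddTorus (Fin 3), ⟪Torus.convect gpForce gpForce x, lambMode x⟫_ℝ = 2 * Real.pi * (3 / 4)) ∧
      (∫ x : UnitAddTorus (Fin 3), ⟪Torus.convect lambMode lambMode x, gpForce x⟫_ℝ = 0) ∧
      (∫ x : UnitAddTorus (Fin 3), ⟪Torus.convect lambMode lambMode x, lambMode x⟫_ℝ = 0) ∧
      (∫ x : UnitAddTorus (Fin 3),
          ⟪Torus.convect gpForce lambMode x + Torus.convect lambMode gpForce x, lambMode x⟫_ℝ = 0) ∧
      (∫ x : UnitAddTorus (Fin 3), ‖gpForce x‖ ^ 2 = 3 / 2) ∧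
      (∫ x : UnitAddTorus (Fin 3), ‖lambMode x‖ ^ 2 = 3 / 4)) →
    ((∀ u : UnitAddTorus (Fin 3) → EuclideanSpace ℝ (Fin 3), Torus.IsSmooth u → Torus.IsDivFree u →
        Torus.HasZeroMean u → Torus.fourierTruncate 1 u = u → IsGPSymmetric u →
        ∃ c : ℝ, u = c • gpForce) ∧
      (∀ u : UnitAddTorus (Fin 3) → EuclideanSpace ℝ (Fin 3), Torus.IsSmooth u → Torus.IsDivFree u →
        Torus.HasZeroMean u → Torus.fourierTruncate 2 u = u → IsGPSymmetric u →
        ∃ c₁ c₂ : ℝ, u = c₁ • gpForce + c₂ • lambMode)) →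
    ∃ E : ℝ, ∀ ν : ℝ, 0 < ν → ν ≤ 1 →
      ∀ (u : ℝ → UnitAddTorus (Fin 3) → EuclideanSpace ℝ (Fin 3)) (U : ℝ → Torus.energySpace (Fin 3)),
        Torus.IsGlobalLerayHopf ν (fun _ => gpForce) 0 u →
        (∀ t, 0 ≤ t → ((U t : Lp (EuclideanSpace ℝ (Fin 3)) 2
            (volume : Measure (UnitAddTorus (Fin 3)))) :
              UnitAddTorus (Fin 3) → EuclideanSpace ℝ (Fin 3)) =ᵐ[volume] u t) →
        (∀ t, 0 ≤ t → IsGPSymmetric (u t)) →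
        meanEnergy u ≤ E := by
  sorry

/-- **T2' `stub_steadyBoundedSequence`** — THE CONTENT in its weakest steady form (printed open:
Constantin–Tarfulea–Vicol 2013, p. 3, "the existence of bounded sequences of stationary solutions of the
periodic, forced Navier–Stokes equations … are open problems"): along SOME viscosities `ν_j ∈ (0, 1]`,
`ν_j → 0`, there are steady weak solutions `u_j ∈ V = H ∩ H¹` of `NS_{ν_j}(f_GP)` with `ν`-UNIFORMLY bounded
energy `∫‖u_j‖² ≤ E`.  (Cycle-2 reshape of T2 `stub_steadyBoundedBranch`: the branch over every `ν ∈ (0,1]`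
is weakened to a sequence, and the energy-equality conjunct is dropped because in `d = 3` it is a theorem,
`Temam1979_steadyWeakSolution_energy_eq_holds`.)  Numerical status (LINE-REPORT-c2.md): the primary
`G`-symmetric steady branch — the state DNS from rest converges to (j020324) and Newton continuation from
`ν = 1` follows (j006377/j014392, same branch to 3 digits after the exact unit conversion) — has
`∫‖u‖² = 0.19, 0.24, 0.32, 0.40, 0.50, 0.62, 0.69, 0.73, 0.77, 0.81, 0.86` at
`Re = 1/ν = 16, 20, 26, 37, 57, 95, 158, 264, 341, 440, 562`: growth `≈ 0.1` per octave of `Re`, not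
visibly saturating; any bounded steady sequence (this branch or another) closes the crux through
`SteadyWeakIsGlobalLerayHopf` (in tree). -/
theorem stub_steadyBoundedSequence :
    ∃ (E : ℝ) (ν : ℕ → ℝ), (∀ j, 0 < ν j ∧ ν j ≤ 1) ∧ Tendsto ν atTop (nhds 0) ∧
      ∀ j, ∃ u : Torus.energySpace (Fin 3),
        (u : Lp (EuclideanSpace ℝ (Fin 3)) 2 (volume : Measure (UnitAddTorus (Fin 3)))) ∈
            Torus.energySpaceV (Fin 3) ∧
        Torus.IsSteadyWeakSolution (ν j) gpForce u ∧
        ∫ x, ‖(u : Lp (EuclideanSpace ℝ (Fin 3)) 2 (volume : Measure (UnitAddTorus (Fin 3)))) x‖ ^ 2 ≤ E := by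
  sorry

/-- `f_GP` is smooth, solenoidal and mean zero (the landed `stub_gpAdmissible`, whose inline force is
`gpForce` by `rfl`). -/
theorem gpForce_admissible :
    Torus.IsSmooth gpForce ∧ Torus.IsDivFree gpForce ∧ Torus.HasZeroMean gpForce :=
  Summit.AnomalousDissipation.AnomalousDissipation.Theorems.SteadyStatesLoudBounded.GpAdmissible.stub_gpAdmissible

/-- The viscosity sequence `ν_j = 1/(j+2)`: in `(0, 1]` and tending to `0`. -/
theorem viscositySeq_spec :
    (∀ j : ℕ, 0 < 1 / ((j : ℝ) + 2) ∧ 1 / ((j : ℝ) + 2) ≤ 1) ∧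
      Tendsto (fun j : ℕ => 1 / ((j : ℝ) + 2)) atTop (nhds 0) := by
  refine ⟨fun j => ⟨by positivity, ?_⟩, ?_⟩
  · rw [div_le_one (by positivity)]
    linarith [(Nat.cast_nonneg j : (0 : ℝ) ≤ j)]
  · have h : Tendsto (fun n : ℕ => 1 / ((n : ℝ) + 1)) atTop (nhds 0) :=
      tendsto_one_div_add_atTop_nhds_zero_nat
    have h2 : Tendsto (fun j : ℕ => 1 / ((j : ℝ) + 1 + 1)) atTop (nhds 0) := by
      simpa using (tendsto_add_atTop_iff_nat 1).2 h
    refine h2.congr fun j => ?_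
    ring_nf

/-- **The crux from the stubs, route A (steady sequence; primary).** Take `(E, ν_j, u_j)` from T2';
in `d = 3` every steady weak solution in `V` satisfies the energy equality `ν‖∇u‖² = (u, f)`
(`Temam1979_steadyWeakSolution_energy_eq_holds`), so by `SteadyWeakIsGlobalLerayHopf` (in tree) the
constant path `t ↦ u_j` is a global Leray–Hopf solution of `NS_{ν_j}(f_GP)` from datum `u_j` with
`meanEnergy = ∫‖u_j‖² ≤ E`, and it is its own `H`-valued lift. -/
theorem GPMeanBoundedFamily_of :
    Summit.AnomalousDissipation.AnomalousDissipation.Theses.EnsembleRigidity.GPMeanBoundedFamily := by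
  intro f hf
  have hfg : f = gpForce := hf.trans gpForce_eq.symm
  subst hfg
  obtain ⟨E, ν, hν, hν0, hE⟩ := stub_steadyBoundedSequence
  obtain ⟨hfs, -, hfz⟩ := gpForce_admissible
  have hf2 : MemLp gpForce 2 (volume : Measure (UnitAddTorus (Fin 3))) := hfs.memLp 2
  have key : ∀ j : ℕ, ∃ u : Torus.energySpace (Fin 3),
      Torus.IsGlobalLerayHopf (ν j) (fun _ => gpForce)
        ((u : Lp (EuclideanSpace ℝ (Fin 3)) 2 (volume : Measure (UnitAddTorus (Fin 3)))) :
          UnitAddTorus (Fin 3) → EuclideanSpace ℝ (Fin 3))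
        (fun _ => ((u : Lp (EuclideanSpace ℝ (Fin 3)) 2 (volume : Measure (UnitAddTorus (Fin 3)))) :
          UnitAddTorus (Fin 3) → EuclideanSpace ℝ (Fin 3))) ∧
      meanEnergy (fun _ : ℝ => ((u : Lp (EuclideanSpace ℝ (Fin 3)) 2 (volume : Measure (UnitAddTorus (Fin 3)))) :
          UnitAddTorus (Fin 3) → EuclideanSpace ℝ (Fin 3))) ≤ E := fun j => by
    obtain ⟨u, hV, hsol, hEu⟩ := hE j
    have heq : ν j * (Torus.eGradNormSq ((u : Lp (EuclideanSpace ℝ (Fin 3)) 2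
        (volume : Measure (UnitAddTorus (Fin 3)))) : UnitAddTorus (Fin 3) → EuclideanSpace ℝ (Fin 3))).toReal =
          Torus.pairing (u : Lp (EuclideanSpace ℝ (Fin 3)) 2 (volume : Measure (UnitAddTorus (Fin 3)))) gpForce :=
      Torus.Temam1979_steadyWeakSolution_energy_eq_holds
        (by norm_num [Fintype.card_fin] : Fintype.card (Fin 3) ≤ 4) hf2 hV hsol
    obtain ⟨hLH, hmean, -⟩ :=
      Summit.AnomalousDissipation.AnomalousDissipation.Theorems.taylorCertificates_steadyWeakIsGlobalLerayHopf_proof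
        _ gpForce u (hν j).1 hfs hfz hV hsol heq
    exact ⟨u, hLH, hmean.le.trans hEu⟩
  choose u hLH hmean using key
  refine ⟨E, ν,
    fun j => ((u j : Lp (EuclideanSpace ℝ (Fin 3)) 2 (volume : Measure (UnitAddTorus (Fin 3)))) :
      UnitAddTorus (Fin 3) → EuclideanSpace ℝ (Fin 3)),
    fun j _ => ((u j : Lp (EuclideanSpace ℝ (Fin 3)) 2 (volume : Measure (UnitAddTorus (Fin 3)))) :
      UnitAddTorus (Fin 3) → EuclideanSpace ℝ (Fin 3)),
    fun j _ => u j, hν, hν0, hLH, fun j t _ => Filter.EventuallyEq.rfl, hmean⟩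

/-- **The crux from the stubs, route B (time-dependent symmetric ceiling).** Take `E` from the ceiling
S7 (fed with the head identities S1–S4); for each `j` put `ν_j = 1/(j+2) ∈ (0, 1]`, `ν_j → 0`, take the
symmetric scheme S5 at `ν_j` and its symmetric Leray–Hopf limit from rest with `H`-lift S6; the ceiling
bounds its limsup-mean energy. -/
theorem GPMeanBoundedFamily_of_ceiling :
    Summit.AnomalousDissipation.AnomalousDissipation.Theses.EnsembleRigidity.GPMeanBoundedFamily := by
  intro f hf
  have hfg : f = gpForce := hf.trans gpForce_eq.symm
  subst hfg
  obtain ⟨E, hE⟩ :=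
    stub_symmetricMeanCeiling stub_headModes stub_lambIdentity stub_headCoefficients stub_headPinned
  -- viscosities `ν_j = 1/(j+2)`
  obtain ⟨hν, hν0⟩ := viscositySeq_spec
  set ν : ℕ → ℝ := fun j => 1 / ((j : ℝ) + 2) with hν_def
  have hνpos : ∀ j, 0 < ν j := fun j => (hν j).1
  have hνle : ∀ j, ν j ≤ 1 := fun j => (hν j).2
  -- per-viscosity symmetric solutions from rest
  have key : ∀ j, ∃ (u : ℝ → UnitAddTorus (Fin 3) → EuclideanSpace ℝ (Fin 3))
      (U' : ℝ → Torus.energySpace (Fin 3)),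
      Torus.IsGlobalLerayHopf (ν j) (fun _ => gpForce) 0 u ∧
      (∀ t, 0 ≤ t → ((U' t : Lp (EuclideanSpace ℝ (Fin 3)) 2
          (volume : Measure (UnitAddTorus (Fin 3)))) :
            UnitAddTorus (Fin 3) → EuclideanSpace ℝ (Fin 3)) =ᵐ[volume] u t) ∧
      ∀ t, 0 ≤ t → IsGPSymmetric (u t) := fun j => by
    obtain ⟨N, F, U, hS, hsym⟩ := stub_symmetricScheme (ν j) (hνpos j)
    exact stub_symmetricLimit (ν j) (hνpos j) N F U hS hsym
  choose u U' hLH hlift hsym using key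
  refine ⟨E, ν, fun _ => 0, u, U', fun j => ⟨hνpos j, hνle j⟩, hν0, hLH, fun j => hlift j, fun j => ?_⟩
  exact hE (ν j) (hνpos j) (hνle j) (u j) (U' j) (hLH j) (hlift j) (hsym j)

end Summit.AnomalousDissipation.AnomalousDissipation.Theorems.EnsembleRigidity.GPMeanBoundedFamily

end
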